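import Summits.AtomisticToContinuum.HydrodynamicLimit.Theorems.KineticCurrentsWindowLDUniform.Negative.WindowFubini
import Literature.MathematicalPhysics.KineticTheory.HardSphereEulerProofs
import HarnessLib

/-!
# Static hydrodynamic domination — preliminaries
# (helper file for stub `stub_staticHydroDomination`, line `local-gibbs-entropy-ledger`,
# crux `KineticCurrentsWindowLDUniform`, stmt-AtomisticToContinuum-14662)

The stub (proved in `OneFlightGossipEngineKineticCurrentsWindowLDUniformStaticHydroDomination`)
dominates the Maxwellian average `∫ F(x,v) M_{1,θ,u}(v) dv` of an observable orthogonal to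
`1, vⱼ, ‖v‖²` under `M_{1,θ₀(x),u₀(x)}` by the Gaussian relative entropy. After the affine change of
variables `v = u₀ + √θ₀ w` everything reduces to the reference state `(θ₀, u₀) = (1, 0)`; this file
supplies the ingredients of that normalised estimate:

* real inequalities: `|e^q - 1 - q| ≤ q²(1 + e^q)`; for `h(s) = s - 1 - log s`: `h ≥ (s-1)²/6` near
  `1`, monotonicity on each side of `1`, `h ≥ 1/96` off `|s-1| < 1/4`, `s ≤ 2h + 2`, `|log s| ≤ 2|s-1|`;
* Gaussian tools on `V3 = ℝ³`: transfer `∫ g M_{1,θ,u} dv = ∫ g(u + √θ w) dγ(w)`, Lebesgue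
  integrability of `g · M_{1,θ,u}` for continuous `g` of polynomial growth, the moment bound
  `∫ (1+‖v‖²)^m M_{1,θ,u} ≤ (1 + 2‖u‖² + 2θ)^m ∫ (1+‖w‖²)^m dγ`, and the global crude bound
  `|∫ G M_{1,s,ũ}| ≤ C (1 + 2‖ũ‖² + 2s) ∫(1+‖w‖²) dγ` for `|G| ≤ C(1+‖w‖²)`;
* the exponential tilt `M_{1,s,ũ} = M_{1,1,0} e^{q}`, `q(w) = -(3/2) log s - ‖w-ũ‖²/(2s) + ‖w‖²/2 ∈
  span{1, wⱼ, ‖w‖²}`, and `q² ≤ 100 (‖ũ‖² + (s-1)²)(1+‖w‖²)²` for `‖ũ‖ ≤ 1`, `|s-1| ≤ 1/4`.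
Folklore calculus / Gaussian facts throughout; constants are explicit and not optimised.
-/

noncomputable section

open MeasureTheory Set Filter ProbabilityTheory
open scoped ENNReal Topology

namespace Summit.AtomisticToContinuum.HydrodynamicLimit.Theorems.KineticCurrentsWindowLDUniformLocalGibbs

open Literature.Analysis.FluidPDE (localMaxwellian)
open Literature.MathematicalPhysics.KineticTheory (T3 V3 gaussMeasure localMaxwellian_nonneg
  continuous_localMaxwellian integral_localMaxwellian_smul withDensity_localMaxwellian_eq_gaussMeasure)
open Summit.AtomisticToContinuum.HydrodynamicLimit.Theorems.KineticCurrentsWindowTilt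
  (integrable_one_add_norm_sq_pow integrable_gaussMeasure_of_growth one_add_norm_shift_sq_le)

/-! ### Elementary real inequalities -/

/-- `|e^q - 1 - q| ≤ q² (1 + e^q)` for every real `q` (from `1 + x ≤ eˣ` only). [folklore] -/
theorem shd_abs_exp_sub_one_sub_le (q : ℝ) :
    |Real.exp q - 1 - q| ≤ q ^ 2 * (1 + Real.exp q) := by
  have h1 : q + 1 ≤ Real.exp q := Real.add_one_le_exp q
  have h2 : -q + 1 ≤ Real.exp (-q) := Real.add_one_le_exp (-q)
  have hpos : 0 < Real.exp q := Real.exp_pos q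
  have hprod : Real.exp q * Real.exp (-q) = 1 := by
    rw [← Real.exp_add, add_neg_cancel, Real.exp_zero]
  have h3 : Real.exp q * (1 - q) ≤ 1 := by
    calc Real.exp q * (1 - q) ≤ Real.exp q * Real.exp (-q) :=
          mul_le_mul_of_nonneg_left (by linarith) hpos.le
      _ = 1 := hprod
  have h4 : Real.exp q - 1 ≤ q * Real.exp q := by nlinarith
  rw [abs_le]
  constructor
  · nlinarith [sq_nonneg q, hpos]
  · rcases le_total 0 q with hq | hq
    · have h6 : q * (Real.exp q - 1) ≤ q * (q * Real.exp q) := mul_le_mul_of_nonneg_left h4 hq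
      nlinarith [sq_nonneg q]
    · have h5 : 1 - Real.exp q ≤ -q := by linarith
      have h6 : (-q) * (1 - Real.exp q) ≤ (-q) * (-q) :=
        mul_le_mul_of_nonneg_left h5 (by linarith)
      nlinarith [sq_nonneg q, hpos]

/-- Second order at `1`: `(s-1)²/6 ≤ s - 1 - log s` for `|s - 1| ≤ 1/4` (Taylor remainder of
`log (1 - x)`). [folklore] -/
theorem shd_h_near {s : ℝ} (hs : |s - 1| ≤ 1 / 4) :
    (s - 1) ^ 2 / 6 ≤ s - 1 - Real.log s := by
  have hxa : |1 - s| ≤ 1 / 4 := by rw [abs_sub_comm]; exact hs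
  have hx1 : |1 - s| < 1 := hxa.trans_lt (by norm_num)
  have h := Real.abs_log_sub_add_sum_range_le hx1 2
  have hs' : 1 - (1 - s) = s := by ring
  rw [hs'] at h
  norm_num [Finset.sum_range_succ] at h
  have h3 : |1 - s| ^ 3 / (1 - |1 - s|) ≤ (1 - s) ^ 2 / 3 := by
    rw [div_le_iff₀ (by linarith)]
    have h' : |1 - s| ^ 3 = |1 - s| * (1 - s) ^ 2 := by
      rw [pow_succ', sq_abs]
    rw [h']
    nlinarith [sq_nonneg (1 - s), abs_nonneg (1 - s)]
  have h4 := (abs_le.1 (h.trans h3)).2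
  nlinarith [h4]

/-- `h` is monotone on `[1, ∞)`. [folklore] -/
theorem shd_h_mono_right {a b : ℝ} (ha : 1 ≤ a) (hab : a ≤ b) :
    a - 1 - Real.log a ≤ b - 1 - Real.log b := by
  have ha0 : 0 < a := by linarith
  have hb0 : 0 < b := by linarith
  have h1 : Real.log (b / a) = Real.log b - Real.log a := Real.log_div hb0.ne' ha0.ne'
  have h2 : Real.log (b / a) ≤ b / a - 1 := Real.log_le_sub_one_of_pos (div_pos hb0 ha0)
  have h3 : b / a - 1 = (b - a) / a := by field_simp
  have h4 : (b - a) / a ≤ b - a := div_le_self (by linarith) ha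
  linarith

/-- `h` is antitone on `(0, 1]`. [folklore] -/
theorem shd_h_mono_left {a b : ℝ} (ha : 0 < a) (hab : a ≤ b) (hb : b ≤ 1) :
    b - 1 - Real.log b ≤ a - 1 - Real.log a := by
  have hb0 : 0 < b := by linarith
  have h1 : Real.log (b / a) = Real.log b - Real.log a := Real.log_div hb0.ne' ha.ne'
  have h2 : 1 - (b / a)⁻¹ ≤ Real.log (b / a) := Real.one_sub_inv_le_log_of_pos (div_pos hb0 ha)
  have h3 : (b / a)⁻¹ = a / b := by rw [inv_div]
  have h4 : 1 - a / b = (b - a) / b := by field_simp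
  have h5 : b - a ≤ (b - a) / b := le_div_self (by linarith) hb0 hb
  linarith

/-- Far from `1`: `1/96 ≤ h(s)` whenever `|s - 1| ≥ 1/4`. [folklore] -/
theorem shd_h_far {s : ℝ} (hs : 0 < s) (h : 1 / 4 ≤ |s - 1|) :
    1 / 96 ≤ s - 1 - Real.log s := by
  have hval : ((5 : ℝ) / 4 - 1) ^ 2 / 6 = 1 / 96 := by norm_num
  have hval' : ((3 : ℝ) / 4 - 1) ^ 2 / 6 = 1 / 96 := by norm_num
  rcases le_or_gt 1 s with h1 | h1
  · rw [abs_of_nonneg (by linarith)] at h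
    have hn := shd_h_near (s := 5 / 4) (by norm_num)
    have hm := shd_h_mono_right (a := 5 / 4) (b := s) (by norm_num) (by linarith)
    linarith
  · rw [abs_of_neg (by linarith)] at h
    have hn := shd_h_near (s := 3 / 4) (by norm_num)
    have hm := shd_h_mono_left (a := s) (b := 3 / 4) hs (by linarith) (by norm_num)
    linarith

/-- Linear growth: `s ≤ 2 h(s) + 2`. [folklore] -/
theorem shd_le_two_mul_h {s : ℝ} (hs : 0 < s) : s ≤ 2 * (s - 1 - Real.log s) + 2 := by
  have h1 : Real.log (s / 2) ≤ s / 2 - 1 := Real.log_le_sub_one_of_pos (by positivity)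
  have h2 : Real.log (s / 2) = Real.log s - Real.log 2 := Real.log_div hs.ne' (by norm_num)
  have h3 : Real.log 2 ≤ 1 := by
    have := Real.log_le_sub_one_of_pos (by norm_num : (0 : ℝ) < 2)
    linarith
  linarith

/-- `|log s| ≤ 2 |s - 1|` for `|s - 1| ≤ 1/4`. [folklore] -/
theorem shd_abs_log_le {s : ℝ} (hs : |s - 1| ≤ 1 / 4) : |Real.log s| ≤ 2 * |s - 1| := by
  have hs' := abs_le.1 hs
  have hs0 : 0 < s := by linarith
  have h1 : Real.log s ≤ s - 1 := Real.log_le_sub_one_of_pos hs0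
  have h2 : 1 - s⁻¹ ≤ Real.log s := Real.one_sub_inv_le_log_of_pos hs0
  rw [abs_le]
  constructor
  · rcases le_total 1 s with h | h
    · rw [abs_of_nonneg (by linarith)]
      have : s⁻¹ ≤ 1 := inv_le_one_of_one_le₀ h
      linarith
    · rw [abs_of_nonpos (by linarith)]
      have h3 : s⁻¹ ≤ 4 / 3 := by
        rw [inv_le_comm₀ hs0 (by norm_num)]
        linarith
      have h4 : 1 - s⁻¹ = (s - 1) * s⁻¹ := by field_simp
      nlinarith [inv_pos.2 hs0]
  · calc Real.log s ≤ s - 1 := h1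
      _ ≤ |s - 1| := le_abs_self _
      _ ≤ 2 * |s - 1| := by linarith [abs_nonneg (s - 1)]

/-- Pure-real form of the coefficient estimate for the tilt exponent
`q = -(3/2) L - N/(2s) + r²/2` (`L = log s`, `N = ‖w - ũ‖²`, `r = ‖w‖`, `d = ‖ũ‖`). [folklore] -/
theorem shd_q_sq_le_real {s L N r d : ℝ} (hs : |s - 1| ≤ 1 / 4) (hL : |L| ≤ 2 * |s - 1|)
    (hd0 : 0 ≤ d) (hd1 : d ≤ 1) (hN : |r ^ 2 - N| ≤ d * (2 * r + d)) :
    (-(3 / 2) * L - N / (2 * s) + r ^ 2 / 2) ^ 2 ≤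
      100 * (d ^ 2 + (s - 1) ^ 2) * (1 + r ^ 2) ^ 2 := by
  have hs' := abs_le.1 hs
  have hs0 : 0 < s := by linarith
  have hq : -(3 / 2) * L - N / (2 * s) + r ^ 2 / 2 =
      (-3 * s * L + (s - 1) * r ^ 2 + (r ^ 2 - N)) / (2 * s) := by
    field_simp
    ring
  rw [hq, div_pow, div_le_iff₀ (by positivity)]
  have hP2 : (-3 * s * L + (s - 1) * r ^ 2 + (r ^ 2 - N)) ^ 2 ≤
      3 * ((3 * s * L) ^ 2 + ((s - 1) * r ^ 2) ^ 2 + (r ^ 2 - N) ^ 2) := by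
    nlinarith [sq_nonneg (-3 * s * L - (s - 1) * r ^ 2),
      sq_nonneg ((s - 1) * r ^ 2 - (r ^ 2 - N)), sq_nonneg (-3 * s * L - (r ^ 2 - N))]
  have hL2 : L ^ 2 ≤ 4 * (s - 1) ^ 2 := by
    have h1 : |L| ^ 2 ≤ (2 * |s - 1|) ^ 2 := pow_le_pow_left₀ (abs_nonneg L) hL 2
    rw [sq_abs, mul_pow, sq_abs] at h1
    linarith
  have hsL : (3 * s * L) ^ 2 ≤ 57 * (s - 1) ^ 2 := by
    have h1 : (3 * s) ^ 2 ≤ (15 / 4) ^ 2 := pow_le_pow_left₀ (by linarith) (by linarith) 2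
    rw [mul_pow]
    nlinarith [sq_nonneg L, sq_nonneg (s - 1)]
  have hN2 : (r ^ 2 - N) ^ 2 ≤ d ^ 2 * (8 * r ^ 2 + 2) := by
    have h1 : |r ^ 2 - N| ^ 2 ≤ (d * (2 * r + d)) ^ 2 := pow_le_pow_left₀ (abs_nonneg _) hN 2
    rw [sq_abs, mul_pow] at h1
    have h2 : (2 * r + d) ^ 2 ≤ 8 * r ^ 2 + 2 := by nlinarith [sq_nonneg (2 * r - 1)]
    nlinarith [sq_nonneg d]
  have hs2 : 9 / 4 ≤ (2 * s) ^ 2 := by nlinarith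
  have hX : 0 ≤ (d ^ 2 + (s - 1) ^ 2) * (1 + r ^ 2) ^ 2 := by positivity
  have hmain : 3 * ((3 * s * L) ^ 2 + ((s - 1) * r ^ 2) ^ 2 + (r ^ 2 - N) ^ 2) ≤
      225 * ((d ^ 2 + (s - 1) ^ 2) * (1 + r ^ 2) ^ 2) := by
    nlinarith [sq_nonneg r, sq_nonneg d, sq_nonneg (s - 1), mul_nonneg (sq_nonneg d) (sq_nonneg r),
      mul_nonneg (sq_nonneg (s - 1)) (sq_nonneg r),
      mul_nonneg (mul_nonneg (sq_nonneg d) (sq_nonneg r)) (sq_nonneg r),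
      mul_nonneg (mul_nonneg (sq_nonneg (s - 1)) (sq_nonneg r)) (sq_nonneg r)]
  calc (-3 * s * L + (s - 1) * r ^ 2 + (r ^ 2 - N)) ^ 2
      ≤ 225 * ((d ^ 2 + (s - 1) ^ 2) * (1 + r ^ 2) ^ 2) := hP2.trans hmain
    _ = 100 * (d ^ 2 + (s - 1) ^ 2) * (1 + r ^ 2) ^ 2 * (9 / 4) := by ring
    _ ≤ 100 * (d ^ 2 + (s - 1) ^ 2) * (1 + r ^ 2) ^ 2 * (2 * s) ^ 2 :=
        mul_le_mul_of_nonneg_left hs2 (by positivity)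

/-! ### Gaussian tools on `V3` -/

/-- Transfer identity: `∫ g M_{1,θ,u} dv = ∫ g(u + √θ w) dγ(w)` (no integrability needed). [folklore] -/
theorem shd_integral_mul_localMaxwellian (g : V3 → ℝ) (u : V3) {θ : ℝ} (hθ : 0 < θ) :
    ∫ v, g v * localMaxwellian 1 θ u v = ∫ w, g (u + Real.sqrt θ • w) ∂stdGaussian V3 := by
  simp_rw [mul_comm (g _) _]
  exact integral_localMaxwellian_smul hθ u g

/-- A continuous function of polynomial growth is integrable under the standard Gaussian. [folklore] -/
theorem shd_integrable_stdGaussian_of_growth {g : V3 → ℝ} (hg : Continuous g) {C : ℝ} {m : ℕ}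
    (hC : ∀ w, |g w| ≤ C * (1 + ‖w‖ ^ 2) ^ m) : Integrable g (stdGaussian V3) := by
  refine ((integrable_one_add_norm_sq_pow m).const_mul C).mono' hg.aestronglyMeasurable
    (ae_of_all _ fun w => ?_)
  rw [Real.norm_eq_abs]
  exact hC w

/-- `g · M_{1,θ,u}` is Lebesgue integrable for continuous `g` of polynomial growth (`θ > 0`). [folklore] -/
theorem shd_integrable_mul_localMaxwellian {g : V3 → ℝ} (hg : Continuous g) {C : ℝ} {m : ℕ}
    (hC : ∀ v, |g v| ≤ C * (1 + ‖v‖ ^ 2) ^ m) (u : V3) {θ : ℝ} (hθ : 0 < θ) :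
    Integrable (fun v => g v * localMaxwellian 1 θ u v) := by
  have h := integrable_gaussMeasure_of_growth hg hC u hθ
  rw [← withDensity_localMaxwellian_eq_gaussMeasure hθ u,
    integrable_withDensity_iff (continuous_localMaxwellian 1 θ u).measurable.ennreal_ofReal
      (Eventually.of_forall fun _ => ENNReal.ofReal_lt_top)] at h
  refine h.congr (Eventually.of_forall fun v => ?_)
  simp only [ENNReal.toReal_ofReal (localMaxwellian_nonneg zero_le_one hθ.le u v)]

/-- Moment bound: `∫ (1+‖v‖²)^m M_{1,θ,u}(v) dv ≤ (1 + 2‖u‖² + 2θ)^m ∫ (1+‖w‖²)^m dγ(w)`. [folklore] -/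
theorem shd_integral_moment_le (m : ℕ) (u : V3) {θ : ℝ} (hθ : 0 < θ) :
    ∫ v, (1 + ‖v‖ ^ 2) ^ m * localMaxwellian 1 θ u v ≤
      (1 + 2 * ‖u‖ ^ 2 + 2 * θ) ^ m * ∫ w, (1 + ‖w‖ ^ 2) ^ m ∂stdGaussian V3 := by
  rw [shd_integral_mul_localMaxwellian _ u hθ, ← integral_const_mul]
  refine integral_mono_of_nonneg (Eventually.of_forall fun w => by positivity)
    ((integrable_one_add_norm_sq_pow m).const_mul _) (Eventually.of_forall fun w => ?_)
  simp only
  rw [← mul_pow]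
  exact pow_le_pow_left₀ (by positivity) (one_add_norm_shift_sq_le u w hθ) m

/-- Linear combinations of the moments `∫ G`, `∫ G wⱼ`, `∫ G ‖w‖²`. [folklore] -/
theorem shd_integral_affine_comb {μ : Measure V3} {G : V3 → ℝ} (h0 : Integrable G μ)
    (h1 : ∀ j, Integrable (fun w => G w * w j) μ) (h2 : Integrable (fun w => G w * ‖w‖ ^ 2) μ)
    (a c : ℝ) (b : Fin 3 → ℝ) :
    ∫ w, G w * (a + ∑ j, b j * w j + c * ‖w‖ ^ 2) ∂μ =
      a * ∫ w, G w ∂μ + ∑ j, b j * ∫ w, G w * w j ∂μ + c * ∫ w, G w * ‖w‖ ^ 2 ∂μ := by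
  have hf : (fun w => G w * (a + ∑ j, b j * w j + c * ‖w‖ ^ 2)) =
      fun w => a * G w + ∑ j, b j * (G w * w j) + c * (G w * ‖w‖ ^ 2) := by
    funext w
    have : G w * ∑ j, b j * w j = ∑ j, b j * (G w * w j) := by
      rw [Finset.mul_sum]
      exact Finset.sum_congr rfl fun j _ => by ring
    rw [mul_add, mul_add, this]
    ring
  have hs : Integrable (fun w => ∑ j, b j * (G w * w j)) μ :=
    integrable_finsetSum _ fun j _ => (h1 j).const_mul (b j)
  rw [hf, integral_add _ (h2.const_mul c), integral_add (h0.const_mul a) hs, integral_const_mul,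
    integral_const_mul, integral_finsetSum _ fun j _ => (h1 j).const_mul (b j)]
  · simp only [integral_const_mul]
  · exact (h0.const_mul a).add hs

/-- `|w j| ≤ 1 + ‖w‖²` for a coordinate of `w ∈ ℝ³`. [folklore] -/
theorem shd_abs_apply_le (w : V3) (j : Fin 3) : |w j| ≤ 1 + ‖w‖ ^ 2 := by
  have h1 : |w j| ≤ ‖w‖ := by
    have := PiLp.norm_apply_le w j
    rwa [Real.norm_eq_abs] at this
  nlinarith [sq_nonneg (‖w‖ - 1), norm_nonneg w]

/-! ### The exponential tilt between two isotropic Maxwellians -/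

/-- The tilt exponent `q(w) = -(3/2) log s - ‖w - ũ‖²/(2s) + ‖w‖²/2` (the logarithm of
`M_{1,s,ũ} / M_{1,1,0}` on `ℝ³`, passed as a function `q` with its defining equations) is
continuous. [folklore] -/
theorem shd_continuous_tilt {s : ℝ} {ũ : V3} {q : V3 → ℝ}
    (hq : ∀ w, q w = -(3 / 2) * Real.log s - ‖w - ũ‖ ^ 2 / (2 * s) + ‖w‖ ^ 2 / 2) :
    Continuous q := by
  rw [show q = fun w => -(3 / 2) * Real.log s - ‖w - ũ‖ ^ 2 / (2 * s) + ‖w‖ ^ 2 / 2 from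
    funext hq]
  fun_prop

/-- **Tilt identity**: `M_{1,s,ũ}(w) = M_{1,1,0}(w) e^{q(w)}` for `s > 0`, with the tilt exponent
`q(w) = -(3/2) log s - ‖w - ũ‖²/(2s) + ‖w‖²/2`. [folklore] -/
theorem shd_localMaxwellian_eq_mul_exp {s : ℝ} (hs : 0 < s) (ũ w : V3) {q : V3 → ℝ}
    (hq : ∀ w, q w = -(3 / 2) * Real.log s - ‖w - ũ‖ ^ 2 / (2 * s) + ‖w‖ ^ 2 / 2) :
    localMaxwellian 1 s ũ w = localMaxwellian 1 1 (0 : V3) w * Real.exp (q w) := by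
  have hD : (Module.finrank ℝ V3 : ℝ) = 3 := by
    simp [finrank_euclideanSpace]
  simp only [Literature.Analysis.FluidPDE.localMaxwellian, hq, hD, one_mul, mul_one, sub_zero]
  rw [Real.mul_rpow (by positivity) hs.le, Real.rpow_def_of_pos hs]
  simp only [mul_assoc, ← Real.exp_add]
  congr 2
  ring

/-- The tilt exponent lies in `span{1, wⱼ, ‖w‖²}`, with explicit coefficients. [folklore] -/
theorem shd_tilt_eq_affine {s : ℝ} (hs : 0 < s) (ũ w : V3) {q : V3 → ℝ}
    (hq : ∀ w, q w = -(3 / 2) * Real.log s - ‖w - ũ‖ ^ 2 / (2 * s) + ‖w‖ ^ 2 / 2) :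
    q w = (-(3 / 2) * Real.log s - ‖ũ‖ ^ 2 / (2 * s)) +
      ∑ j, (ũ j / s) * w j + (1 / 2 - 1 / (2 * s)) * ‖w‖ ^ 2 := by
  simp only [hq, EuclideanSpace.real_norm_sq_eq, PiLp.sub_apply, Fin.sum_univ_three]
  field_simp
  ring

/-- **Coefficient estimate**: `q(w)² ≤ 100 (‖ũ‖² + (s-1)²)(1 + ‖w‖²)²` for `‖ũ‖ ≤ 1`,
`|s - 1| ≤ 1/4`. [folklore] -/
theorem shd_tilt_sq_le {s : ℝ} (hs : |s - 1| ≤ 1 / 4) {ũ : V3} (hu : ‖ũ‖ ≤ 1) (w : V3)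
    {q : V3 → ℝ}
    (hq : ∀ w, q w = -(3 / 2) * Real.log s - ‖w - ũ‖ ^ 2 / (2 * s) + ‖w‖ ^ 2 / 2) :
    q w ^ 2 ≤ 100 * (‖ũ‖ ^ 2 + (s - 1) ^ 2) * (1 + ‖w‖ ^ 2) ^ 2 := by
  have hN : |‖w‖ ^ 2 - ‖w - ũ‖ ^ 2| ≤ ‖ũ‖ * (2 * ‖w‖ + ‖ũ‖) := by
    have h1 : |‖w‖ - ‖w - ũ‖| ≤ ‖ũ‖ := by
      simpa [sub_sub_cancel] using abs_norm_sub_norm_le w (w - ũ)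
    have h2 : ‖w - ũ‖ ≤ ‖w‖ + ‖ũ‖ := norm_sub_le _ _
    rw [sq_sub_sq, abs_mul, abs_of_nonneg (by positivity : (0 : ℝ) ≤ ‖w‖ + ‖w - ũ‖)]
    calc (‖w‖ + ‖w - ũ‖) * |‖w‖ - ‖w - ũ‖| ≤ (2 * ‖w‖ + ‖ũ‖) * ‖ũ‖ :=
          mul_le_mul (by linarith) h1 (abs_nonneg _) (by positivity)
      _ = ‖ũ‖ * (2 * ‖w‖ + ‖ũ‖) := by ring
  rw [hq]
  exact shd_q_sq_le_real hs (shd_abs_log_le hs) (norm_nonneg ũ) hu hN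

/-- Near `(1, 0)` the tilt exponent has quadratic growth:
`|q| ≤ (1 + 100(‖ũ‖² + (s-1)²))(1+‖w‖²)²`. [folklore] -/
theorem shd_abs_tilt_le {s : ℝ} (hs : |s - 1| ≤ 1 / 4) {ũ : V3} (hu : ‖ũ‖ ≤ 1) (w : V3)
    {q : V3 → ℝ}
    (hq : ∀ w, q w = -(3 / 2) * Real.log s - ‖w - ũ‖ ^ 2 / (2 * s) + ‖w‖ ^ 2 / 2) :
    |q w| ≤ (1 + 100 * (‖ũ‖ ^ 2 + (s - 1) ^ 2)) * (1 + ‖w‖ ^ 2) ^ 2 := by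
  have h := shd_tilt_sq_le hs hu w hq
  have h1 : |q w| ≤ 1 + q w ^ 2 := by
    rcases le_total 0 (q w) with h0 | h0
    · rw [abs_of_nonneg h0]; nlinarith [sq_nonneg (q w - 1)]
    · rw [abs_of_nonpos h0]; nlinarith [sq_nonneg (q w + 1)]
  have h2 : (1 : ℝ) ≤ (1 + ‖w‖ ^ 2) ^ 2 := one_le_pow₀ (by nlinarith [norm_nonneg w])
  nlinarith [h2, sq_nonneg ‖ũ‖, sq_nonneg (s - 1)]

/-! ### Growth constants, global bound and Gaussian moments of the observable -/

/-- A growth constant is nonnegative. [folklore] -/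
theorem shd_const_nonneg {G : V3 → ℝ} {C : ℝ} (hGb : ∀ w, |G w| ≤ C * (1 + ‖w‖ ^ 2)) : 0 ≤ C := by
  have h := hGb 0
  simp only [norm_zero, ne_eq, OfNat.ofNat_ne_zero, not_false_eq_true, zero_pow, add_zero,
    mul_one] at h
  exact (abs_nonneg _).trans h

/-- **Global crude bound**: `|∫ G M_{1,s,ũ}| ≤ C (1 + 2‖ũ‖² + 2s) ∫ (1+‖w‖²) dγ`. [folklore] -/
theorem shd_global_bound {G : V3 → ℝ} {C : ℝ}
    (hGb : ∀ w, |G w| ≤ C * (1 + ‖w‖ ^ 2)) (ũ : V3) {s : ℝ} (hs : 0 < s) :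
    |∫ w, G w * localMaxwellian 1 s ũ w| ≤
      C * ((1 + 2 * ‖ũ‖ ^ 2 + 2 * s) * ∫ w, (1 + ‖w‖ ^ 2) ∂stdGaussian V3) := by
  have hC : 0 ≤ C := shd_const_nonneg hGb
  have hbound : Integrable (fun w => C * (1 + ‖w‖ ^ 2) * localMaxwellian 1 s ũ w) := by
    refine shd_integrable_mul_localMaxwellian (g := fun w => C * (1 + ‖w‖ ^ 2)) (by fun_prop)
      (C := C) (m := 1) (fun v => ?_) ũ hs
    rw [pow_one, abs_of_nonneg (by positivity)]
  have h1 : |∫ w, G w * localMaxwellian 1 s ũ w| ≤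
      ∫ w, C * (1 + ‖w‖ ^ 2) * localMaxwellian 1 s ũ w := by
    have h := norm_integral_le_of_norm_le hbound (Eventually.of_forall fun w => (?_ :
      ‖G w * localMaxwellian 1 s ũ w‖ ≤ C * (1 + ‖w‖ ^ 2) * localMaxwellian 1 s ũ w))
    · simpa only [Real.norm_eq_abs] using h
    · have hM := localMaxwellian_nonneg zero_le_one hs.le ũ w
      rw [Real.norm_eq_abs, abs_mul, abs_of_nonneg hM]
      exact mul_le_mul_of_nonneg_right (hGb w) hM
  have h2 : ∫ w, C * (1 + ‖w‖ ^ 2) * localMaxwellian 1 s ũ w =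
      C * ∫ w, (1 + ‖w‖ ^ 2) * localMaxwellian 1 s ũ w := by
    simp_rw [mul_assoc]
    exact integral_const_mul _ _
  have h3 := shd_integral_moment_le 1 ũ hs
  simp only [pow_one] at h3
  rw [h2] at h1
  exact h1.trans (mul_le_mul_of_nonneg_left h3 hC)

/-- Standard-Gaussian integrability of `G`, `G wⱼ`, `G ‖w‖²` for continuous `G` of quadratic
growth. [folklore] -/
theorem shd_integrable_moments {G : V3 → ℝ} (hG : Continuous G) {C : ℝ}
    (hGb : ∀ w, |G w| ≤ C * (1 + ‖w‖ ^ 2)) :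
    Integrable G (stdGaussian V3) ∧ (∀ j : Fin 3, Integrable (fun w => G w * w j) (stdGaussian V3)) ∧
      Integrable (fun w => G w * ‖w‖ ^ 2) (stdGaussian V3) := by
  have hC : 0 ≤ C := shd_const_nonneg hGb
  refine ⟨shd_integrable_stdGaussian_of_growth hG (C := C) (m := 1) (by simpa using hGb),
    fun j => ?_, ?_⟩
  · refine shd_integrable_stdGaussian_of_growth (hG.mul (by fun_prop)) (C := C) (m := 2)
      fun w => ?_
    rw [abs_mul]
    calc |G w| * |w j| ≤ C * (1 + ‖w‖ ^ 2) * (1 + ‖w‖ ^ 2) :=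
          mul_le_mul (hGb w) (shd_abs_apply_le w j) (abs_nonneg _) (by positivity)
      _ = C * (1 + ‖w‖ ^ 2) ^ 2 := by ring
  · refine shd_integrable_stdGaussian_of_growth (hG.mul (by fun_prop)) (C := C) (m := 2)
      fun w => ?_
    rw [abs_mul, abs_of_nonneg (by positivity : (0 : ℝ) ≤ ‖w‖ ^ 2)]
    calc |G w| * ‖w‖ ^ 2 ≤ C * (1 + ‖w‖ ^ 2) * (1 + ‖w‖ ^ 2) :=
          mul_le_mul (hGb w) (by nlinarith [norm_nonneg w]) (by positivity) (by positivity)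
      _ = C * (1 + ‖w‖ ^ 2) ^ 2 := by ring

/-- **Registered helper stub `stub_staticHydroDomination_prelim`** (helper file of S1
`stub_staticHydroDomination`, line `local-gibbs-entropy-ledger`, crux stmt-AtomisticToContinuum-14662):
the global crude bound `|∫ G M_{1,s,u}| ≤ C (1 + 2‖u‖² + 2s) ∫ (1 + ‖w‖²) dγ` for an observable of
quadratic growth `|G| ≤ C (1 + ‖w‖²)` (`shd_global_bound`). [folklore] -/
theorem stub_staticHydroDomination_prelim :
    ∀ (G : V3 → ℝ) (C : ℝ), (∀ w, |G w| ≤ C * (1 + ‖w‖ ^ 2)) → ∀ (u : V3) (s : ℝ), 0 < s →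
      |∫ w, G w * localMaxwellian 1 s u w| ≤
        C * ((1 + 2 * ‖u‖ ^ 2 + 2 * s) * ∫ w, (1 + ‖w‖ ^ 2) ∂ProbabilityTheory.stdGaussian V3) :=
  fun _ _ hGb u _ hs => shd_global_bound hGb u hs

end Summit.AtomisticToContinuum.HydrodynamicLimit.Theorems.KineticCurrentsWindowLDUniformLocalGibbs

end
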